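import Summits.QuantumFields.YangMills.Theorems.BalabanUVNodesN15TwoGridFirstOrderByParts
import Summits.QuantumFields.YangMills.Theorems.BalabanUVNodesN15BackgroundPairSpace
import Summits.QuantumFields.YangMills.Theorems.BalabanUVNodesN15NeumannCubeRightEntries
import HarnessLib

/-!
# N15 (NE2) — PROGRAMME M-II «THE FIRST-ORDER LAYER BY PARTS», part II-B: THE LETTERS OF THE VALUE-ONLY FIXED POINT — the face term `(1 − A′_μ)PX ≤ L^{−k}·∇_μX`, the by-parts step
# `G′V₁′ ≤ (βr_c + (d+1)(C_∇r_a + βr_b))e^{−δd}`, the coarse jet `(X, ∇_μX)` of n15-b's `bgPair` and its (3.65) fixed point in the shape II-A consumes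

WHO ∕ WHEN.  Cell `pub-ymgap`, seat `pub-ymgap-dag-n15-a` (KNIT-BY-NAME seat of Track-A DAG node N15 = NE2, g24); `--kind proof --supports stmt-QuantumFields-27366 --as helper` (K3⁸;
count-neutral).  Over part II-A `…TwoGridFirstOrderByParts` (`idef_firstOrder_fix`, `comp_mulOp_grad_byParts`, `mulOp_comp_sD_eq`), n15-b B1b `…BackgroundPairSpace` (`bgPair`, `stack`, `unstack`,
`projO`, `blkPair`, `projO_none_bgPair`, `projO_some_bgPair_of_comp`, `hasMaj_stack`, `hasMaj_unstack`, `hasMaj_projO_comp`; through it `bgPropV`, `hasMaj_bgPropV`, `isUnit_stepV`,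
`hasMaj_step`), parts 34∕35 (`symbOp_sA_apply`, `kingPr_add_smul_unitVec_of_le`) BY NAME; nothing in the tree is modified.
WHY.  II-A reduced the η-defect of the first-order dressed pair to `𝔇₀ = S + (G′V₁′)𝔇₀`; this file supplies the block majorants of the NEW letters in `S` and of the step — from landed
`U ≡ 1` rows and (3.35)-LEGITIMATE coefficient letters only: sup of `c, a, ∇⁻a` ([B9] p.396: `|A|`, `|∇^ηA|`), the cell oscillation of `a` (one rate factor below its sup by the same gradient
letter); NO regularity letter on the zeroth-order coefficient `c`.
WHAT ([folklore] bookkeeping; 0 def).  §15 helpers (`hasMaj_mulOp_comp`, `hasMaj_comp_diagK_const`, `diagK_const_mono`; part 3's `hasMaj_finsum` BY NAME).  §16 ★ `abs_pull_sub_sA_pull_le` (pointwise: `|(P − A′_μP)u (x′)| ≤ n⁻¹|(∇_μu)(πx′)|` — each fine step inside a cell moves King's pairing by at most one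
coarse step), ★★ `hasMaj_pull_sub_sA_pull_comp` (`(P − A′_μP)∘T ≤ n⁻¹·K` from `∇_μ∘T ≤ K`: THE FACE TERM COSTS `L^{−k}`).  §17 ★ `hasMaj_byPartsPiece`, ★★ `hasMaj_byPartsStep` (`G′∘(M_{c′} + ΣM_{a′_μ}∇′_μ)
≤ (βr_c + (d+1)(C_∇r_a + βr_b))·e^{−δd}` from `G′ ≤ βe^{−δd}`, `G′∇′_μ ≤ C_∇e^{−δd}`, `|c′| ≤ r_c`, `|a′| ≤ r_a`, `|n′(a′ − a′(·−e))| ≤ r_b` — by parts, II-A).  §18 the coarse jet: `jetX`-free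
statements about `projO none ∘ bgPair G (∇∘G) c a` and `projO (some μ) ∘ …`: ★ `bgPair_value_fix` (the (3.65) fixed point in II-A's shape), `bgPair_grad_eq` (`Y_μ = ∇_μ∘X`), ★ `hasMaj_bgPair_comp`
(every component `≤ β(1 − βRc_r)⁻¹·e^{−ρd}`, `R ≥ r(1+|J|)`), `bgPair_value_fix'` (the fine fixed point in the `V₁′` shape).
EDITION v1.0.1 (doc-only; every declaration byte-identical): ref-B READ-916 NIT-L2 — the (3.65) fixed point is printed on p.402 (p0014 L37), not p.403; two docstring locators corrected.
HONEST FRAMING ∕ LIMITS.  Block-majorant bookkeeping over hypothesis-shaped `U ≡ 1` data and n15-b's constructed jet; no estimate of [B5]∕[B6]∕[B9] asserted; NE2⁺ NOT printed ∕ proved; no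
statement of record touched; N15 NOT discharged; K3⁸ OPEN; counts UNMOVED (typed 28∕28 · discharged 5∕27); NOT infinite volume ∕ OS ∕ mass gap ∕ Clay.
-/

noncomputable section

open scoped BigOperators
open Finset

namespace Summit.QuantumFields.YangMills.BalabanUVNodes.N15.TwoGrid

open Literature.MathematicalPhysics.QuantumFieldTheory.Balaban1983to89
open Literature.MathematicalPhysics.QuantumFieldTheory.Balaban1983to89.B11SectG (BlockNorm HasMaj hasMaj_comp hasMaj_sum RowSum)
open Literature.MathematicalPhysics.QuantumFieldTheory.Balaban1983to89.B11AxialTransport190 (abs_le_loc_ofBlocks loc_ofBlocks_le)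
open Literature.MathematicalPhysics.QuantumFieldTheory.Balaban1983to89.T4EtaRateDefect (idef)
open Literature.MathematicalPhysics.QuantumFieldTheory.Balaban1983to89.T4EtaRateCoeffDefect (pull pull_apply diagK diagK_same diagK_ne)
open Summit.QuantumFields.YangMills.BalabanUVNodes.N15.DerivDefect (sum_mul_diagK)
open Literature.MathematicalPhysics.QuantumFieldTheory.Balaban1983to89.B6RandomWalk (Triangle254)
open Literature.MathematicalPhysics.QuantumFieldTheory.Balaban1983to89.B6Prop26Gluing (mulOp mulOp_apply)
open Literature.MathematicalPhysics.QuantumFieldTheory.Balaban1983to89.B5Prop11Plancherel (Tor fine unitVec)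
open Literature.MathematicalPhysics.QuantumFieldTheory.King1986.Torus (blockOf tdistT tdistT_nonneg)
open Literature.MathematicalPhysics.QuantumFieldTheory.Balaban1983to89.B6UnitTorusCarrier (unitTorusGeo)
open Summit.QuantumFields.YangMills.BalabanUVNodes.N15.VectorPiece (blkFine kingPr kingPrV kingPrV_eq blkFine_comp_kingPrV)
open Summit.QuantumFields.YangMills.BalabanUVNodes.N15.BackgroundModel (kappa_ofBlocks)
open Summit.QuantumFields.YangMills.BalabanUVNodes.N15.BackgroundLayer (bgPropV bgPair stack unstack projO blkPair projO_none_bgPair projO_some_bgPair_of_comp hasMaj_stack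
  hasMaj_unstack hasMaj_projO_comp hasMaj_bgPropV isUnit_stepV hasMaj_step)

variable {d : ℕ}

/-! ## §15 Bookkeeping helpers: a bounded multiplier after a majorised operator, a decaying operator after a diagonal one -/

section Helpers

variable {g : B6.Geometry} {F₁ F₂ : Type} [AddCommGroup F₁] [Module ℝ F₁] [AddCommGroup F₂] [Module ℝ F₂]

variable {X X₂ : Type} [Fintype X] [Fintype X₂] (blk : X → g.Site) (blk₂ : X₂ → g.Site)

/-- A BOUNDED MULTIPLIER AFTER A MAJORISED OPERATOR: `|c| ≤ r`, `T ≤ K` (`K ≥ 0`) `⟹ M_c∘T ≤ r·K`. [folklore] -/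
theorem hasMaj_mulOp_comp {b₁ : BlockNorm g F₁} {T : F₁ →ₗ[ℝ] (X → ℝ)} {K : g.Site → g.Site → ℝ} (hK : ∀ y y', 0 ≤ K y y') {c : X → ℝ} {r : ℝ} (hr : 0 ≤ r)
    (hc : ∀ x, |c x| ≤ r) (hT : HasMaj b₁ (BlockNorm.ofBlocks g blk) T K) : HasMaj b₁ (BlockNorm.ofBlocks g blk) (mulOp c ∘ₗ T) (fun y y' => r * K y y') := by
  intro y' v hv y
  refine loc_ofBlocks_le blk _ (mul_nonneg (mul_nonneg hr (hK y y')) (b₁.loc_nonneg y' v)) fun x hx => ?_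
  rw [LinearMap.comp_apply, mulOp_apply, abs_mul, mul_assoc]
  exact mul_le_mul (hc x) ((abs_le_loc_ofBlocks blk (T v) hx).trans (hT y' v hv y)) (abs_nonneg _) hr

/-- A DECAYING OPERATOR AFTER A DIAGONAL ONE: `G ≤ βe^{−δd}` on `X`, `V ≤ diagK o` from `X₂` into `X` `⟹ G∘V ≤ β·o·e^{−δd}`. [folklore] -/
theorem hasMaj_comp_diagK_const {G : (X → ℝ) →ₗ[ℝ] (X → ℝ)} {V : (X₂ → ℝ) →ₗ[ℝ] (X → ℝ)} {β δ o : ℝ} (hβ : 0 ≤ β)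
    (hG : HasMaj (BlockNorm.ofBlocks g blk) (BlockNorm.ofBlocks g blk) G (fun y y' => β * Real.exp (-(δ * g.dist y y'))))
    (hV : HasMaj (BlockNorm.ofBlocks g blk₂) (BlockNorm.ofBlocks g blk) V (diagK fun _ => o)) :
    HasMaj (BlockNorm.ofBlocks g blk₂) (BlockNorm.ofBlocks g blk) (G ∘ₗ V) (fun y y' => β * o * Real.exp (-(δ * g.dist y y'))) := by
  have key := hasMaj_comp hG hV (fun _ _ => mul_nonneg hβ (Real.exp_nonneg _))
  refine key.mono fun a b => le_of_eq ?_
  rw [kappa_ofBlocks]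
  simp only [one_mul]
  rw [sum_mul_diagK]
  ring

/-- constant diagonal kernels are monotone in the constant. [folklore] -/
theorem diagK_const_mono {o o' : ℝ} (h : o ≤ o') (y y' : g.Site) : diagK (g := g) (fun _ => o) y y' ≤ diagK (fun _ => o') y y' := by
  classical
  by_cases hy : y = y'
  · subst hy; rw [diagK_same, diagK_same]; exact h
  · rw [diagK_ne _ hy, diagK_ne _ hy]

end Helpers

/-! ## §16 The face term: `(P − A′_μP)u` is `L^{−k}` times the coarse gradient -/

section Face

variable {L : ℕ} [NeZero L] (M : Fin (d + 1) → ℕ) [∀ μ, NeZero (M μ)] (k m : ℕ)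

/-- ★ **THE FACE TERM, POINTWISE**: `|(Pu − A′_μPu)(x′, a)| ≤ n⁻¹·|(∇_μu)(π(x′, a))|` — each of the `L^m` box-filter steps moves King's pairing by at most one coarse step, and one coarse step of a
prolongated function is `n⁻¹` times the coarse difference quotient `∇_μ = ρ(sD_μ n)`, `n = L^k`. [cite: King1986, p.664 (pairing convention «x′ ∈ B^n(x)»)] -/
theorem abs_pull_sub_sA_pull_le (μ : Fin (d + 1)) (u : Tor (fine (L ^ k) M) × Fin (d + 1) → ℝ) (z : Tor (fine (L ^ m * L ^ k) M) × Fin (d + 1)) :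
    |(pull (kingPrV L k m M) u - symbOp M (L ^ m * L ^ k) (sA M (L ^ m * L ^ k) μ (L ^ m)) (pull (kingPrV L k m M) u)) z| ≤
      (((L ^ k : ℕ) : ℝ))⁻¹ * |symbOp M (L ^ k) (sD M (L ^ k) μ ((L ^ k : ℕ) : ℝ)) u (kingPrV L k m M z)| := by
  have hℓ0 : 0 < L ^ m := pow_pos (Nat.pos_of_ne_zero (NeZero.ne L)) m
  have hℓr : (0 : ℝ) < ((L ^ m : ℕ) : ℝ) := by exact_mod_cast hℓ0
  have hn0 : (0 : ℝ) < ((L ^ k : ℕ) : ℝ) := by exact_mod_cast pow_pos (Nat.pos_of_ne_zero (NeZero.ne L)) k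
  -- each step term is `0` or `−n⁻¹·(∇_μ u)(π z)`
  have hstep : ∀ j ∈ range (L ^ m), |u (kingPrV L k m M z) - u (kingPrV L k m M (z.1 + j • unitVec (fine (L ^ m * L ^ k) M) μ, z.2))| ≤
      (((L ^ k : ℕ) : ℝ))⁻¹ * |symbOp M (L ^ k) (sD M (L ^ k) μ ((L ^ k : ℕ) : ℝ)) u (kingPrV L k m M z)| := by
    intro j hj
    obtain ⟨δ, hδ, hpr⟩ := kingPr_add_smul_unitVec_of_le M L k m z.1 μ (le_of_lt (mem_range.mp hj))
    rw [kingPrV_eq, kingPrV_eq, hpr]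
    interval_cases δ
    · rw [zero_smul, add_zero, sub_self, abs_zero]; positivity
    · rw [one_smul, symbOp_sD_apply, abs_mul, abs_of_pos hn0, ← mul_assoc, inv_mul_cancel₀ hn0.ne', one_mul, abs_sub_comm]
  rw [Pi.sub_apply, symbOp_sA_apply, pull_apply]
  calc |u (kingPrV L k m M z) - ((L ^ m : ℕ) : ℝ)⁻¹ * ∑ j ∈ range (L ^ m), pull (kingPrV L k m M) u (z.1 + j • unitVec (fine (L ^ m * L ^ k) M) μ, z.2)|
      = |((L ^ m : ℕ) : ℝ)⁻¹ * ∑ j ∈ range (L ^ m), (u (kingPrV L k m M z) - u (kingPrV L k m M (z.1 + j • unitVec (fine (L ^ m * L ^ k) M) μ, z.2)))| := by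
        congr 1
        rw [sum_sub_distrib, sum_const, card_range, nsmul_eq_mul, mul_sub, ← mul_assoc, inv_mul_cancel₀ hℓr.ne', one_mul]
        simp only [pull_apply]
    _ ≤ ((L ^ m : ℕ) : ℝ)⁻¹ * ∑ j ∈ range (L ^ m), |u (kingPrV L k m M z) - u (kingPrV L k m M (z.1 + j • unitVec (fine (L ^ m * L ^ k) M) μ, z.2))| := by
        rw [abs_mul, abs_of_pos (inv_pos.mpr hℓr)]
        exact mul_le_mul_of_nonneg_left (abs_sum_le_sum_abs _ _) (inv_nonneg.mpr hℓr.le)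
    _ ≤ ((L ^ m : ℕ) : ℝ)⁻¹ * ∑ _j ∈ range (L ^ m), (((L ^ k : ℕ) : ℝ))⁻¹ * |symbOp M (L ^ k) (sD M (L ^ k) μ ((L ^ k : ℕ) : ℝ)) u (kingPrV L k m M z)| :=
        mul_le_mul_of_nonneg_left (sum_le_sum hstep) (inv_nonneg.mpr hℓr.le)
    _ = _ := by rw [sum_const, card_range, nsmul_eq_mul, ← mul_assoc, inv_mul_cancel₀ hℓr.ne', one_mul]

/-- ★★ **THE FACE TERM COSTS ONE RATE FACTOR**: if the coarse gradient row `∇_μ∘T ≤ K` (`K ≥ 0`; King blocks), then `(P − A′_μP)∘T ≤ (L^k)⁻¹·K` into the fine unit blocks.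
[cite: King1986, p.664 (pairing convention); Balaban1984PropagatorsI, (1.31) p.23 (difference quotient)] -/
theorem hasMaj_pull_sub_sA_pull_comp {F₁ : Type} [AddCommGroup F₁] [Module ℝ F₁] {b₁ : BlockNorm (unitTorusGeo L k M) F₁} {T : F₁ →ₗ[ℝ] (Tor (fine (L ^ k) M) × Fin (d + 1) → ℝ)}
    {K : Tor M → Tor M → ℝ} (hK : ∀ y y', 0 ≤ K y y') (μ : Fin (d + 1))
    (hT : HasMaj b₁ (BlockNorm.ofBlocks (unitTorusGeo L k M) (blkFine L k M)) (symbOp M (L ^ k) (sD M (L ^ k) μ ((L ^ k : ℕ) : ℝ)) ∘ₗ T) K) :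
    HasMaj b₁ (BlockNorm.ofBlocks (unitTorusGeo L k M) (fun i : Tor (fine (L ^ m * L ^ k) M) × Fin (d + 1) => blockOf (L ^ m * L ^ k) M i.1))
      ((pull (kingPrV L k m M) - symbOp M (L ^ m * L ^ k) (sA M (L ^ m * L ^ k) μ (L ^ m)) ∘ₗ pull (kingPrV L k m M)) ∘ₗ T)
      (fun y y' => (((L ^ k : ℕ) : ℝ))⁻¹ * K y y') := by
  intro y' v hv y
  have hn0 : (0 : ℝ) ≤ (((L ^ k : ℕ) : ℝ))⁻¹ := by positivity
  refine loc_ofBlocks_le (g := unitTorusGeo L k M) _ _ (mul_nonneg (mul_nonneg hn0 (hK y y')) (b₁.loc_nonneg y' v)) fun z hz => ?_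
  have hblk : blkFine L k M (kingPrV L k m M z) = y := by rw [← hz]; exact congrFun (blkFine_comp_kingPrV M L k m) z
  rw [LinearMap.comp_apply, LinearMap.sub_apply, LinearMap.comp_apply]
  refine (abs_pull_sub_sA_pull_le M k m μ (T v) z).trans ?_
  rw [mul_assoc]
  refine mul_le_mul_of_nonneg_left ?_ hn0
  have h := hT y' v hv y
  rw [LinearMap.comp_apply] at h
  exact (abs_le_loc_ofBlocks (g := unitTorusGeo L k M) (blkFine L k M) _ hblk).trans h

end Face

/-! ## §17 The by-parts step `G′∘V₁′` -/

section Step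

variable {L : ℕ} (M : Fin (d + 1) → ℕ) [∀ μ, NeZero (M μ)] (k : ℕ) (n : ℕ) [NeZero n]

/-- ★ **ONE BY-PARTS PIECE**: `G′∘(M_{a′}∘∇′_μ) ≤ (C_∇r_a + βr_b)·e^{−δd}` from `G′ ≤ βe^{−δd}`, the source-gradient row `G′∘∇′_μ ≤ C_∇e^{−δd}`, `|a′| ≤ r_a` and the backward-quotient
letter `|n(a′ − a′(·−e_μ))| ≤ r_b` — via `M_{a′}∇′_μ = ∇′_μM_{a′(·−e)} − M_{n(a′−a′(·−e))}` (II-A).  Both coefficient letters are [B9] (3.35)'s (`|A|`, `|∇^ηA|`).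
[cite: Balaban1985BackgroundPropagators, (3.35) p.396, (3.63) p.402 (shapes); Balaban1984PropagatorsI, Prop. 1.2 (1.110) p.35 (letter «G∇J»)] -/
theorem hasMaj_byPartsPiece {G' : (Tor (fine n M) × Fin (d + 1) → ℝ) →ₗ[ℝ] (Tor (fine n M) × Fin (d + 1) → ℝ)} {a' : Tor (fine n M) × Fin (d + 1) → ℝ}
    {β C₂ δ ra rb : ℝ} (hβ : 0 ≤ β) (hC₂ : 0 ≤ C₂) (hra : 0 ≤ ra) (hrb : 0 ≤ rb) (μ : Fin (d + 1))
    (hG' : HasMaj (BlockNorm.ofBlocks (unitTorusGeo L k M) (fun i : Tor (fine n M) × Fin (d + 1) => blockOf n M i.1))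
      (BlockNorm.ofBlocks (unitTorusGeo L k M) (fun i : Tor (fine n M) × Fin (d + 1) => blockOf n M i.1)) G' (fun y y' => β * Real.exp (-(δ * tdistT M y y'))))
    (hG'grad : HasMaj (BlockNorm.ofBlocks (unitTorusGeo L k M) (fun i : Tor (fine n M) × Fin (d + 1) => blockOf n M i.1))
      (BlockNorm.ofBlocks (unitTorusGeo L k M) (fun i : Tor (fine n M) × Fin (d + 1) => blockOf n M i.1)) (G' ∘ₗ symbOp M n (sD M n μ (n : ℝ)))
      (fun y y' => C₂ * Real.exp (-(δ * tdistT M y y'))))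
    (ha' : ∀ z, |a' z| ≤ ra) (hb' : ∀ z, |(n : ℝ) * (a' z - a' (z.1 - unitVec (fine n M) μ, z.2))| ≤ rb) :
    HasMaj (BlockNorm.ofBlocks (unitTorusGeo L k M) (fun i : Tor (fine n M) × Fin (d + 1) => blockOf n M i.1))
      (BlockNorm.ofBlocks (unitTorusGeo L k M) (fun i : Tor (fine n M) × Fin (d + 1) => blockOf n M i.1))
      (G' ∘ₗ (mulOp a' ∘ₗ symbOp M n (sD M n μ (n : ℝ)))) (fun y y' => (C₂ * ra + β * rb) * Real.exp (-(δ * tdistT M y y'))) := by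
  set blk' : Tor (fine n M) × Fin (d + 1) → Tor M := fun i => blockOf n M i.1 with hblk'
  rw [comp_mulOp_grad_byParts G' (symbOp M n (sD M n μ (n : ℝ))) (mulOp_comp_sD_eq M n μ (n : ℝ) a')]
  have hA := hasMaj_step (g := unitTorusGeo L k M) blk' hC₂ hra hG'grad (c := fun z => a' (z.1 - unitVec (fine n M) μ, z.2)) fun z => ha' _
  have hB := hasMaj_step (g := unitTorusGeo L k M) blk' hβ hrb hG' (c := fun z => (n : ℝ) * (a' z - a' (z.1 - unitVec (fine n M) μ, z.2))) fun z => hb' z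
  exact (hA.sub hB).mono fun y y' => by ring_nf; exact le_rfl

/-- ★★ **THE BY-PARTS STEP**: `G′∘(M_{c′} + Σ_μ M_{a′_μ}∘∇′_μ) ≤ (βr_c + (d+1)(C_∇r_a + βr_b))·e^{−δd}` from `G′ ≤ βe^{−δd}`, the source-gradient rows `G′∘∇′_μ ≤ C_∇e^{−δd}` and the sup letters
`|c′| ≤ r_c`, `|a′| ≤ r_a`, `|n(a′ − a′(·−e_μ))| ≤ r_b`; nothing on `∇c′`. [cite: Balaban1985BackgroundPropagators, (3.35) p.396, (3.52) p.400, (3.63) p.402 (shapes)] -/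
theorem hasMaj_byPartsStep {G' : (Tor (fine n M) × Fin (d + 1) → ℝ) →ₗ[ℝ] (Tor (fine n M) × Fin (d + 1) → ℝ)} {c' : Tor (fine n M) × Fin (d + 1) → ℝ}
    {a' : Fin (d + 1) → Tor (fine n M) × Fin (d + 1) → ℝ} {β C₂ δ rc ra rb : ℝ} (hβ : 0 ≤ β) (hC₂ : 0 ≤ C₂) (hrc : 0 ≤ rc) (hra : 0 ≤ ra) (hrb : 0 ≤ rb)
    (hG' : HasMaj (BlockNorm.ofBlocks (unitTorusGeo L k M) (fun i : Tor (fine n M) × Fin (d + 1) => blockOf n M i.1))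
      (BlockNorm.ofBlocks (unitTorusGeo L k M) (fun i : Tor (fine n M) × Fin (d + 1) => blockOf n M i.1)) G' (fun y y' => β * Real.exp (-(δ * tdistT M y y'))))
    (hG'grad : ∀ μ, HasMaj (BlockNorm.ofBlocks (unitTorusGeo L k M) (fun i : Tor (fine n M) × Fin (d + 1) => blockOf n M i.1))
      (BlockNorm.ofBlocks (unitTorusGeo L k M) (fun i : Tor (fine n M) × Fin (d + 1) => blockOf n M i.1)) (G' ∘ₗ symbOp M n (sD M n μ (n : ℝ)))
      (fun y y' => C₂ * Real.exp (-(δ * tdistT M y y'))))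
    (hc' : ∀ z, |c' z| ≤ rc) (ha' : ∀ μ z, |a' μ z| ≤ ra) (hb' : ∀ μ z, |(n : ℝ) * (a' μ z - a' μ (z.1 - unitVec (fine n M) μ, z.2))| ≤ rb) :
    HasMaj (BlockNorm.ofBlocks (unitTorusGeo L k M) (fun i : Tor (fine n M) × Fin (d + 1) => blockOf n M i.1))
      (BlockNorm.ofBlocks (unitTorusGeo L k M) (fun i : Tor (fine n M) × Fin (d + 1) => blockOf n M i.1))
      (G' ∘ₗ (mulOp c' + ∑ μ, mulOp (a' μ) ∘ₗ symbOp M n (sD M n μ (n : ℝ))))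
      (fun y y' => (β * rc + (d + 1) * (C₂ * ra + β * rb)) * Real.exp (-(δ * tdistT M y y'))) := by
  set blk' : Tor (fine n M) × Fin (d + 1) → Tor M := fun i => blockOf n M i.1 with hblk'
  have h0 : HasMaj (BlockNorm.ofBlocks (unitTorusGeo L k M) blk') (BlockNorm.ofBlocks (unitTorusGeo L k M) blk') (G' ∘ₗ mulOp c')
      (fun y y' => β * rc * Real.exp (-(δ * tdistT M y y'))) := hasMaj_step (g := unitTorusGeo L k M) blk' hβ hrc hG' hc'
  have hsum := hasMaj_finsum (b₁ := BlockNorm.ofBlocks (unitTorusGeo L k M) blk') (b₂ := BlockNorm.ofBlocks (unitTorusGeo L k M) blk') Finset.univ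
    (fun μ => G' ∘ₗ (mulOp (a' μ) ∘ₗ symbOp M n (sD M n μ (n : ℝ)))) (fun _ y y' => (C₂ * ra + β * rb) * Real.exp (-(δ * tdistT M y y')))
    fun μ _ => hasMaj_byPartsPiece M k n hβ hC₂ hra hrb μ hG' (hG'grad μ) (ha' μ) (hb' μ)
  have hop : G' ∘ₗ (mulOp c' + ∑ μ, mulOp (a' μ) ∘ₗ symbOp M n (sD M n μ (n : ℝ))) =
      G' ∘ₗ mulOp c' + ∑ μ, G' ∘ₗ (mulOp (a' μ) ∘ₗ symbOp M n (sD M n μ (n : ℝ))) := by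
    rw [LinearMap.comp_add]
    congr 1
    refine LinearMap.ext fun f => ?_
    rw [LinearMap.comp_apply, LinearMap.sum_apply, LinearMap.sum_apply, map_sum]
    rfl
  rw [hop]
  refine (h0.add hsum).mono fun y y' => le_of_eq ?_
  rw [sum_const, card_univ, Fintype.card_fin, nsmul_eq_mul]
  push_cast
  ring

end Step

/-! ## §18 The coarse jet `(X, ∇_μX)` of n15-b's `bgPair` with `D_μ := ∇_μ∘G`: fixed points in II-A's shapes and block majorants -/

section Jet

variable {X : Type} [Fintype X] [DecidableEq X] {g : B6.Geometry} (blk : X → g.Site)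

omit [Fintype X] [DecidableEq X] in
/-- unstacking a composite: `V̂∘T = M_c∘(projO none∘T) + Σ_μ M_{a_μ}∘(projO (some μ)∘T)`. [folklore] -/
theorem unstack_comp {J : Type} [Fintype J] [DecidableEq J] {F : Type} [AddCommGroup F] [Module ℝ F] (c : X → ℝ) (a : J → X → ℝ) (T : F →ₗ[ℝ] (X × Option J → ℝ)) :
    unstack c a ∘ₗ T = mulOp c ∘ₗ (projO none ∘ₗ T) + ∑ μ, mulOp (a μ) ∘ₗ (projO (some μ) ∘ₗ T) := by
  refine LinearMap.ext fun f => funext fun x => ?_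
  simp only [LinearMap.comp_apply, LinearMap.add_apply, LinearMap.sum_apply, Pi.add_apply, Finset.sum_apply, mulOp_apply, BackgroundLayer.unstack_apply,
    BackgroundLayer.projO_apply]

variable {J : Type} [Fintype J] [DecidableEq J] {G : (X → ℝ) →ₗ[ℝ] (X → ℝ)} {Dc : J → (X → ℝ) →ₗ[ℝ] (X → ℝ)} {c : X → ℝ} {a : J → X → ℝ}

/-- ★ **THE VALUE COMPONENT's (3.65) FIXED POINT IN II-A's COARSE SHAPE**: `X = G + G∘(M_cX + Σ_μ M_{a_μ}Y_μ)` with `X = projO none∘bgPair G (∇∘G) c a`, `Y_μ = projO (some μ)∘bgPair …`.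
[cite: Balaban1985BackgroundPropagators, (3.65) p.402 (shape)] -/
theorem bgPair_value_fix (hunit : IsUnit (1 - LinearMap.toMatrix' (stack G (fun μ => Dc μ ∘ₗ G) ∘ₗ unstack c a))) :
    projO none ∘ₗ bgPair G (fun μ => Dc μ ∘ₗ G) c a =
      G + G ∘ₗ (mulOp c ∘ₗ (projO none ∘ₗ bgPair G (fun μ => Dc μ ∘ₗ G) c a) + ∑ μ, mulOp (a μ) ∘ₗ (projO (some μ) ∘ₗ bgPair G (fun μ => Dc μ ∘ₗ G) c a)) := by
  conv_lhs => rw [projO_none_bgPair hunit, unstack_comp]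

/-- THE GRADIENT COMPONENTS ARE THE GRADIENTS OF THE VALUE: `Y_μ = ∇_μ∘X` (n15-b `projO_some_bgPair_of_comp`). [folklore] -/
theorem bgPair_grad_eq (hunit : IsUnit (1 - LinearMap.toMatrix' (stack G (fun μ => Dc μ ∘ₗ G) ∘ₗ unstack c a))) (μ : J) :
    projO (some μ) ∘ₗ bgPair G (fun μ => Dc μ ∘ₗ G) c a = Dc μ ∘ₗ (projO none ∘ₗ bgPair G (fun μ => Dc μ ∘ₗ G) c a) :=
  projO_some_bgPair_of_comp hunit rfl

/-- ★ **THE VALUE COMPONENT's FIXED POINT IN II-A's FINE SHAPE**: `X′ = G′ + G′∘(M_{c′} + Σ_μ M_{a′_μ}∘∇′_μ)∘X′`. [cite: Balaban1985BackgroundPropagators, (3.65) p.402 (shape)] -/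
theorem bgPair_value_fix' (hunit : IsUnit (1 - LinearMap.toMatrix' (stack G (fun μ => Dc μ ∘ₗ G) ∘ₗ unstack c a))) :
    projO none ∘ₗ bgPair G (fun μ => Dc μ ∘ₗ G) c a =
      G + G ∘ₗ ((mulOp c + ∑ μ, mulOp (a μ) ∘ₗ Dc μ) ∘ₗ (projO none ∘ₗ bgPair G (fun μ => Dc μ ∘ₗ G) c a)) := by
  have h := bgPair_value_fix (Dc := Dc) (c := c) (a := a) hunit
  have e : (mulOp c + ∑ μ, mulOp (a μ) ∘ₗ Dc μ) ∘ₗ (projO none ∘ₗ bgPair G (fun μ => Dc μ ∘ₗ G) c a) =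
      mulOp c ∘ₗ (projO none ∘ₗ bgPair G (fun μ => Dc μ ∘ₗ G) c a) + ∑ μ, mulOp (a μ) ∘ₗ (projO (some μ) ∘ₗ bgPair G (fun μ => Dc μ ∘ₗ G) c a) := by
    rw [LinearMap.add_comp]
    congr 1
    refine LinearMap.ext fun f => ?_
    rw [LinearMap.comp_apply, LinearMap.sum_apply, LinearMap.sum_apply]
    refine Finset.sum_congr rfl fun μ _ => ?_
    rw [bgPair_grad_eq hunit μ]
    rfl
  rw [e]
  exact h

/-- ★ **BLOCK MAJORANTS OF THE JET**: from `G ≤ βe^{−δd}`, `∇_μ∘G ≤ βe^{−δd}`, `|c|, |a_μ| ≤ r` and the (2.61) row sum at `σ` (`ρ ≥ 0`, `ρ + σ ≤ δ`), with `q = β·R·c_r < 1`, `R ≥ r(1+|J|)`: every component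
of `bgPair G (∇∘G) c a` is `≤ β(1 − q)⁻¹·e^{−ρd}` (n15-b `hasMaj_bgPropV` on the stacked data), and the stacked step is a unit. [cite: Balaban1985BackgroundPropagators, (3.63)–(3.64) pp.402–403 (mechanism)] -/
theorem hasMaj_bgPair_comp (htri : Triangle254 g) (hd : ∀ x y : g.Site, 0 ≤ g.dist x y) {σ cr : ℝ} (hrow : RowSum g σ cr) (hσ : 0 ≤ σ) {ρ δ β r : ℝ} (hρ : 0 ≤ ρ)
    (hρδ : ρ + σ ≤ δ) (hβ : 0 ≤ β) (hr : 0 ≤ r)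
    (hG : HasMaj (BlockNorm.ofBlocks g blk) (BlockNorm.ofBlocks g blk) G (fun y y' => β * Real.exp (-(δ * g.dist y y'))))
    (hD : ∀ μ, HasMaj (BlockNorm.ofBlocks g blk) (BlockNorm.ofBlocks g blk) (Dc μ ∘ₗ G) (fun y y' => β * Real.exp (-(δ * g.dist y y'))))
    (hc : ∀ x, |c x| ≤ r) (ha : ∀ μ x, |a μ x| ≤ r) {R : ℝ} (hR : r * (1 + Fintype.card J) ≤ R) (hq : β * R * cr < 1) (j : Option J) :
    IsUnit (1 - LinearMap.toMatrix' (stack G (fun μ => Dc μ ∘ₗ G) ∘ₗ unstack c a)) ∧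
    HasMaj (BlockNorm.ofBlocks g blk) (BlockNorm.ofBlocks g blk) (projO j ∘ₗ bgPair G (fun μ => Dc μ ∘ₗ G) c a)
      (fun y y' => β * (1 - β * R * cr)⁻¹ * Real.exp (-(ρ * g.dist y y'))) := by
  have hS := hasMaj_stack (g := g) blk (fun _ _ => mul_nonneg hβ (Real.exp_nonneg _)) hG hD
  have hR0 : 0 ≤ r * (1 + Fintype.card J) := by positivity
  have hV := (hasMaj_unstack (g := g) blk hr hc ha).mono fun y y' => diagK_const_mono hR y y'
  refine ⟨isUnit_stepV blk (blkPair blk) hd hrow (by linarith) hβ (hR0.trans hR) hS hV hq, ?_⟩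
  exact hasMaj_projO_comp blk (hasMaj_bgPropV blk (blkPair blk) htri hd hrow hσ hρ hρδ hβ (hR0.trans hR) hS hV hq) j

end Jet

end Summit.QuantumFields.YangMills.BalabanUVNodes.N15.TwoGrid

end
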